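import Literature.NumberTheory.DiophantineGeometry.BelyiTheorem
import HarnessLib

/-!
# Composition of Belyi functions with Belyi polynomials; the `S₃`-symmetry

Topic `NumberTheory/DiophantineGeometry`; theorem-only companion of `BelyiDegreeFaltingsHeight.lean`
(the notions `IsBelyiFunction`, `belyiDegree`) and `BelyiTheorem.lean`, in the orbit of
[cite: Javanpeykar2014] (whose Belyi degree `deg_B(X)` is the minimal degree of a Belyi function).
Classical closure properties of the set of Belyi functions of a function field `F/K`:

* the anharmonic group: `IsBelyiFunction.inv` (`f ↦ 1/f`, permuting `0, ∞`), with
  `IsBelyiFunction.one_sub` of `BelyiDegreeFaltingsHeight` (`f ↦ 1 - f`, permuting `0, 1`) these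
  generate the `S₃` of Möbius transformations preserving `{0, 1, ∞}`; the degree `[F : K(f)]` is
  unchanged (`finrank_adjoin_inv`, `finrank_adjoin_one_sub`);
* `finrank_adjoin_aeval`: **`[F : K(β(f))] = deg β · [F : K(f)]`** for a non-constant polynomial
  `β` and `f ∉ K` (the poles of `β(f)` are the poles of `f`, with orders multiplied by `deg β`;
  Stichtenoth Thm. 1.4.11 `deg (y)_∞ = [F : K(y)]`);
* **`IsBelyiFunction.aeval`**: over an algebraically closed field of characteristic `0`, if `f` is a
  Belyi function and `β ∈ K[x]` is a *Belyi polynomial* — its finite critical values lie in `{0, 1}`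
  and `β({0, 1}) ⊆ {0, 1}` — then `β(f)` is a Belyi function (the local computation
  `v_P(β(f) - c) = mult_α(β - c) · v_P(f - α)`, `α = f(P)`, of the proof of
  [cite: BombieriGubler2006, Lemma 12.2.7], both factors being `1` for `c ≠ 0, 1`);
* examples: `IsBelyiFunction.pow` (`β = xⁿ`), `IsBelyiFunction.four_mul_mul_one_sub`
  (`β = 4x(1 - x)`): a curve with a Belyi function of degree `d` has Belyi functions of every degree
  `n d`, `n ≥ 1` (`exists_isBelyiFunction_finrank_eq_mul`).

## References

* E. Bombieri, W. Gubler, *Heights in Diophantine Geometry*, CUP 2006, Lemma 12.2.7 (proof).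
  [BombieriGubler2006]
* A. Javanpeykar, *Polynomial bounds for Arakelov invariants of Belyi curves*, Algebra & Number
  Theory 8 (2014), §1.1. [Javanpeykar2014]
* H. Stichtenoth, *Algebraic Function Fields and Codes*, 2nd ed., GTM 254, Springer 2009,
  Thm. 1.4.11. [Stichtenoth2009]
-/

namespace Literature.NumberTheory.DiophantineGeometry.AlgFunctionField

open Polynomial
open scoped IntermediateField

universe u v

variable {K : Type u} {F : Type v} [Field K] [Field F] [Algebra K F]

/-! ### The anharmonic symmetry `f ↦ 1/f` -/

namespace IsBelyiFunction

/-- **`f ↦ 1/f` preserves Belyi functions** (it permutes `0` and `∞` and fixes `1`): a zero `P`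
of `1/f - c` (`c ≠ 0, 1`) is a zero of `f - 1/c` of the same order, `f` being a unit at `P`.
[folklore] -/
theorem inv {f : F} (h : IsBelyiFunction K f) : IsBelyiFunction K f⁻¹ := by
  have hf0 : f ≠ 0 := fun h0 ↦ h.1 ⟨0, by rw [map_zero, h0]⟩
  refine ⟨?_, fun c hc0 hc1 P hP ↦ ?_⟩
  · rintro ⟨c, hc⟩
    exact h.1 ⟨c⁻¹, by rw [map_inv₀, hc, inv_inv]⟩
  · have hc0' : (c⁻¹ : K) ≠ 0 := inv_ne_zero hc0
    have hc1' : (c⁻¹ : K) ≠ 1 := fun h1 ↦ hc1 (by rw [← inv_inv c, h1, inv_one])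
    have hne : f - algebraMap K F c⁻¹ ≠ 0 := fun h0 ↦ h.1 ⟨c⁻¹, (sub_eq_zero.1 h0).symm⟩
    have hcF : algebraMap K F c ≠ 0 := (_root_.map_ne_zero _).2 hc0
    -- `1/f - c = -c · (f - 1/c) · f⁻¹`
    have key : f⁻¹ - algebraMap K F c = -algebraMap K F c * (f - algebraMap K F c⁻¹) * f⁻¹ := by
      rw [map_inv₀]; field_simp; ring
    have hord : P.ord (f⁻¹ - algebraMap K F c) = P.ord (f - algebraMap K F c⁻¹) - P.ord f := by
      rw [key, P.ord_mul_eq (mul_ne_zero (neg_ne_zero.2 hcF) hne) (inv_ne_zero hf0),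
        P.ord_mul_eq (neg_ne_zero.2 hcF) hne, P.ord_neg, PlaceOver.ord_algebraMap_holds P hc0,
        zero_add, P.ord_inv hf0]
      ring
    -- `f` is a unit at `P`
    have hf : P.ord f = 0 := by
      rcases lt_trichotomy (P.ord f) 0 with hneg | hzero | hpos
      · -- `f` has a pole: `f - 1/c` has the same pole
        exfalso
        have h1 : P.ord f < P.ord (-algebraMap K F c⁻¹) := by
          rw [P.ord_neg, PlaceOver.ord_algebraMap_holds P hc0']; exact hneg
        have h2 := P.ord_add_eq_left_of_lt hf0 (neg_ne_zero.2 ((_root_.map_ne_zero _).2 hc0')) h1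
        rw [← sub_eq_add_neg] at h2
        rw [hord, h2.2, sub_self] at hP
        exact lt_irrefl _ hP
      · exact hzero
      · -- `f` vanishes: `f - 1/c` is a unit, so `1/f - c` has a pole
        exfalso
        have h1 : P.ord (-algebraMap K F c⁻¹) < P.ord f := by
          rw [P.ord_neg, PlaceOver.ord_algebraMap_holds P hc0']; exact hpos
        have h2 := P.ord_add_eq_left_of_lt (neg_ne_zero.2 ((_root_.map_ne_zero _).2 hc0')) hf0 h1
        rw [add_comm, ← sub_eq_add_neg] at h2
        rw [hord, h2.2, P.ord_neg, PlaceOver.ord_algebraMap_holds P hc0', zero_sub] at hP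
        omega
    rw [hord, hf, sub_zero] at hP ⊢
    exact h.ord_sub_eq_one hc0' hc1' P hP

/-- `f ↦ 1/f` is an involution on Belyi functions. [folklore] -/
theorem inv_iff {f : F} : IsBelyiFunction K f⁻¹ ↔ IsBelyiFunction K f :=
  ⟨fun h ↦ by simpa using h.inv, fun h ↦ h.inv⟩

/-- **`f ↦ 1/(1 - f)`** (an element of order `3` of the anharmonic group, cycling `0 ↦ ∞ ↦ 1 ↦ 0`
on the target) preserves Belyi functions. [folklore] -/
theorem one_sub_inv {f : F} (h : IsBelyiFunction K f) : IsBelyiFunction K (1 - f)⁻¹ :=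
  h.one_sub.inv

/-- **`f ↦ f/(f - 1)`** (the remaining involution of the anharmonic group, permuting `1` and `∞`)
preserves Belyi functions: `f/(f - 1) = 1 - 1/(1 - f)`. [folklore] -/
theorem div_sub_one {f : F} (h : IsBelyiFunction K f) : IsBelyiFunction K (f / (f - 1)) := by
  have h1 : f - 1 ≠ 0 := fun h0 ↦ h.1 ⟨1, by rw [map_one]; exact (sub_eq_zero.1 h0).symm⟩
  have key : f / (f - 1) = 1 - (1 - f)⁻¹ := by
    have h1' : (1 : F) - f ≠ 0 := fun h0 ↦ h1 (by rw [← neg_sub, h0, neg_zero])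
    field_simp
    ring
  rw [key]
  exact h.one_sub.inv.one_sub

end IsBelyiFunction

/-- The degree is unchanged under `f ↦ 1/f`: `K(1/f) = K(f)`. [folklore] -/
theorem finrank_adjoin_inv (f : F) : Module.finrank K⟮f⁻¹⟯ F = Module.finrank K⟮f⟯ F := by
  have h := adjoin_inv_sub_algebraMap_eq f (0 : K)
  rw [map_zero, sub_zero] at h
  rw [h]

/-- The degree is unchanged under `f ↦ 1 - f`: `K(1 - f) = K(f)`. [folklore] -/
theorem finrank_adjoin_one_sub (f : F) : Module.finrank K⟮1 - f⟯ F = Module.finrank K⟮f⟯ F := by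
  have heq : K⟮1 - f⟯ = K⟮f⟯ := le_antisymm
    (IntermediateField.adjoin_simple_le_iff.2
      (sub_mem (one_mem _) (IntermediateField.mem_adjoin_simple_self K f)))
    (IntermediateField.adjoin_simple_le_iff.2 (by
      have : 1 - (1 - f) ∈ K⟮1 - f⟯ :=
        sub_mem (one_mem _) (IntermediateField.mem_adjoin_simple_self K (1 - f))
      rwa [sub_sub_cancel] at this))
  rw [heq]

/-! ### The degree of `β(f)` -/

/-- **`[F : K(β(f))] = deg β · [F : K(f)]`** for a non-constant polynomial `β ∈ K[x]` and `f`
transcendental over `K`: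
the poles of `β(f)` are exactly the poles of `f`, with `v_P(β(f)) = deg β · v_P(f)`
(`PlaceOver.ord_aeval_of_ord_neg`), and `[F : K(y)] = deg (y)_∞` (Stichtenoth Thm. 1.4.11,
`sum_neg_ord_mul_degree_eq_finrank`). [cite: Stichtenoth2009, Thm. 1.4.11] -/
theorem finrank_adjoin_aeval [IsAlgFunctionField K F] {f : F} (hft : Transcendental K f)
    {β : K[X]} (hβ : 0 < β.natDegree) :
    Module.finrank K⟮aeval f β⟯ F = β.natDegree * Module.finrank K⟮f⟯ F := by
  classical
  have hf0 : f ≠ 0 := fun h0 ↦ hft (h0 ▸ isAlgebraic_zero)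
  have hβ0 : β ≠ 0 := by rintro rfl; rw [natDegree_zero] at hβ; exact lt_irrefl _ hβ
  set y : F := aeval f β with hy
  have hyt : Transcendental K y :=
    hft.aeval β hβ.ne' (mem_nonZeroDivisors_of_ne_zero (leadingCoeff_ne_zero.2 hβ0))
  -- the poles of `f`
  set T : Finset (PlaceOver K F) := ((principalDivisor K f)⁻).support with hT
  have hTmem : ∀ v, v ∈ T ↔ v.ord f < 0 := fun v ↦ by
    rw [hT, Finsupp.mem_support_iff, Divisor.negPart_apply, principalDivisor_apply_of_ne_zero hf0,
      ne_eq, max_eq_right_iff, not_le, neg_pos]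
  -- `v(y) = deg β · v(f)` at the poles of `f`, `v(y) ≥ 0` elsewhere
  have hpole : ∀ v : PlaceOver K F, v.ord f < 0 → v.ord y = β.natDegree * v.ord f := fun v hv ↦
    (v.ord_aeval_of_ord_neg hv hβ0).2
  have hfin : ∀ v : PlaceOver K F, 0 ≤ v.ord f → 0 ≤ v.ord y := by
    intro v hv
    have hmem : f ∈ v.toValuationSubring := (v.mem_toValuationSubring_iff_ord_nonneg hf0).2 hv
    exact v.ord_nonneg_of_mem (v.aeval_mem hmem β)
  have hTy : ∀ v : PlaceOver K F, v.ord y < 0 → v ∈ T := fun v hv ↦ by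
    rw [hTmem]
    by_contra hge
    exact absurd hv (not_lt.2 (hfin v (not_lt.1 hge)))
  have hfilt : T.filter (fun v ↦ v.ord y < 0) = T.filter (fun v ↦ v.ord f < 0) := by
    refine Finset.filter_congr fun v hv ↦ ?_
    have hvf := (hTmem v).1 hv
    rw [hpole v hvf]
    constructor
    · exact fun _ ↦ hvf
    · exact fun h ↦ mul_neg_of_pos_of_neg (by exact_mod_cast hβ) h
  have h1 := sum_neg_ord_mul_degree_eq_finrank hyt T hTy
  have h2 := sum_neg_ord_mul_degree_eq_finrank hft T fun v hv ↦ (hTmem v).2 hv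
  rw [hfilt] at h1
  have h3 : ∑ v ∈ T with v.ord f < 0, -v.ord y * (v.degree : ℤ) =
      β.natDegree * ∑ v ∈ T with v.ord f < 0, -v.ord f * (v.degree : ℤ) := by
    rw [Finset.mul_sum]
    refine Finset.sum_congr rfl fun v hv ↦ ?_
    rw [hpole v (Finset.mem_filter.1 hv).2]
    ring
  have h4 : (Module.finrank K⟮y⟯ F : ℤ) = β.natDegree * (Module.finrank K⟮f⟯ F : ℤ) := by
    rw [← h1, h3, h2]
  exact_mod_cast h4

/-! ### Composition with Belyi polynomials -/

section algClosed

variable [IsAlgFunctionField K F] [IsAlgClosed K] [CharZero K]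

/-- **Belyi polynomial ∘ Belyi function is Belyi.** Let `K` be algebraically closed of
characteristic `0`, `f` a Belyi function of `F/K`, and `β ∈ K[x]` a non-constant polynomial whose
finite critical values lie in `{0, 1}` and with `β({0, 1}) ⊆ {0, 1}`. Then `β(f)` is a Belyi
function. At a zero `P` of `β(f) - c`, `c ≠ 0, 1`, the function `f` is finite with value
`α = f(P)`, `β(α) = c`, and `v_P(β(f) - c) = mult_α(β - c) · v_P(f - α)`; the first factor is `1`
since `c` is not a critical value, the second since `α ∉ {0, 1}` and `f` is a Belyi function (the
local computation of the proof of [cite: BombieriGubler2006, Lemma 12.2.7]). -/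
theorem IsBelyiFunction.aeval {f : F} (hf : IsBelyiFunction K f) {β : K[X]} (hβ : 0 < β.natDegree)
    (hcrit : ∀ a : K, (derivative β).eval a = 0 → β.eval a = 0 ∨ β.eval a = 1)
    (h01 : ∀ a : K, a = 0 ∨ a = 1 → β.eval a = 0 ∨ β.eval a = 1) :
    IsBelyiFunction K (Polynomial.aeval f β) := by
  classical
  haveI := isIntegrallyClosedIn_of_isAlgClosed (K := K) (F := F)
  have hrat : ∀ P : PlaceOver K F, P.IsRational := PlaceOver.isRational_of_isAlgClosed
  have hft : Transcendental K f := transcendental_of_not_mem_range hf.1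
  have hf0 : f ≠ 0 := fun h0 ↦ hf.1 ⟨0, by rw [map_zero, h0]⟩
  have hβ0 : β ≠ 0 := by rintro rfl; rw [natDegree_zero] at hβ; exact lt_irrefl _ hβ
  set y : F := Polynomial.aeval f β with hy
  refine ⟨?_, fun c hc0 hc1 P hP ↦ ?_⟩
  · -- `β(f) ∉ K`
    rintro ⟨c, hc⟩
    have hyt : Transcendental K y :=
      hft.aeval β hβ.ne' (mem_nonZeroDivisors_of_ne_zero (leadingCoeff_ne_zero.2 hβ0))
    exact hyt (hc ▸ isAlgebraic_algebraMap c)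
  · -- `f` is finite at `P` (at a pole of `f`, `β(f) - c` has a pole)
    have hfin : f ∈ P.toValuationSubring := by
      by_contra hnot
      have hneg : P.ord f < 0 := by
        rwa [← not_le, ← P.mem_toValuationSubring_iff_ord_nonneg hf0]
      have h1 : P.ord y < 0 := by
        rw [(P.ord_aeval_of_ord_neg hneg hβ0).2]
        exact mul_neg_of_pos_of_neg (by exact_mod_cast hβ) hneg
      have h2 : P.ord (y - algebraMap K F c) < 0 := by
        have hy0 : y ≠ 0 := by
          rintro h0; rw [h0, PlaceOver.ord_zero] at h1; exact lt_irrefl _ h1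
        have hlt : P.ord y < P.ord (-algebraMap K F c) := by
          rw [P.ord_neg, PlaceOver.ord_algebraMap_holds P hc0]; exact h1
        have h3 := P.ord_add_eq_left_of_lt hy0 (neg_ne_zero.2 ((_root_.map_ne_zero _).2 hc0)) hlt
        rw [← sub_eq_add_neg] at h3
        rw [h3.2]; exact h1
      omega
    -- local analysis at `α = f(P)`
    set α : K := P.value f with hα
    set p : K[X] := β - C c with hpdef
    have hp0 : p ≠ 0 := by
      intro h0
      have := congr_arg natDegree h0
      rw [hpdef, natDegree_sub_C, natDegree_zero] at this
      omega
    have hyc : y - algebraMap K F c = Polynomial.aeval f p := by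
      rw [hpdef, map_sub, Polynomial.aeval_C, hy]
    rw [hyc] at hP ⊢
    have hball : f - algebraMap K F α ∈ P.ball 1 := (hrat P).sub_value_mem hfin
    have hne : f - algebraMap K F α ≠ 0 := fun h ↦ hf.1 ⟨α, (sub_eq_zero.1 h).symm⟩
    have he : 1 ≤ P.ord (f - algebraMap K F α) := (P.mem_ball_iff_le_ord 1 hne).1 hball
    obtain ⟨-, hord⟩ := P.ord_aeval_of_ord_sub_pos he hp0
    set p' : K[X] := p.comp (X + C α) with hp'def
    have hp'0 : p' ≠ 0 := by
      intro h0
      rw [hp'def, comp_eq_zero_iff] at h0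
      rcases h0 with h0 | ⟨-, h0⟩
      · exact hp0 h0
      · have := congr_arg (fun q : K[X] ↦ q.coeff 1) h0
        simp at this
    have hp'eval : p'.eval 0 = β.eval α - c := by
      rw [hp'def, eval_comp, eval_add, eval_X, eval_C, zero_add, hpdef, eval_sub, eval_C]
    have hp'deriv : (derivative p').eval 0 = (derivative β).eval α := by
      rw [hp'def, derivative_comp, derivative_add, derivative_X, derivative_C, add_zero, one_mul,
        eval_comp, eval_add, eval_X, eval_C, zero_add, hpdef, derivative_sub, derivative_C,
        sub_zero]
    -- `mult_α(β - c) ≥ 1`, i.e. `β(α) = c`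
    have hm1 : 1 ≤ p'.rootMultiplicity 0 := by
      by_contra h0
      have hm0 : p'.rootMultiplicity 0 = 0 := by omega
      rw [hm0, Nat.cast_zero, zero_mul] at hord
      omega
    have hroot : β.eval α = c := by
      have h1 : p'.IsRoot 0 := (rootMultiplicity_pos hp'0).1 hm1
      rw [IsRoot.def, hp'eval] at h1
      exact sub_eq_zero.1 h1
    have hc01 : ¬ (β.eval α = 0 ∨ β.eval α = 1) := by
      rw [hroot]; push Not; exact ⟨hc0, hc1⟩
    -- `mult_α(β - c) = 1`: `c` is not a critical value
    have hm : p'.rootMultiplicity 0 = 1 := by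
      by_contra hm
      have hlt : 1 < p'.rootMultiplicity 0 := by omega
      rw [one_lt_rootMultiplicity_iff_isRoot hp'0] at hlt
      have hd : (derivative β).eval α = 0 := by rw [← hp'deriv]; exact hlt.2
      exact hc01 (hcrit α hd)
    -- `v_P(f - α) = 1`: `α ∉ {0, 1}` and `f` is a Belyi function
    have hα0 : α ≠ 0 := fun h0 ↦ hc01 (h01 α (Or.inl h0))
    have hα1 : α ≠ 1 := fun h1 ↦ hc01 (h01 α (Or.inr h1))
    have he1 : P.ord (f - algebraMap K F α) = 1 := hf.ord_sub_eq_one hα0 hα1 P (by omega)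
    rw [hord, hm, he1, Nat.cast_one, one_mul]

/-- **`fⁿ` is a Belyi function** for a Belyi function `f` and `n ≥ 1` (`β = xⁿ`: the only finite
critical value is `0`, and `β` fixes `0` and `1`), of degree `n · [F : K(f)]`. [folklore] -/
theorem IsBelyiFunction.pow {f : F} (hf : IsBelyiFunction K f) {n : ℕ} (hn : 0 < n) :
    IsBelyiFunction K (f ^ n) := by
  have h := hf.aeval (β := X ^ n) (by rwa [natDegree_X_pow]) ?_ ?_
  · simpa using h
  · intro a ha
    left
    rw [derivative_X_pow, eval_mul, eval_pow, eval_X, mul_eq_zero] at ha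
    rcases ha with ha | ha
    · exfalso
      have : (n : K) ≠ 0 := by exact_mod_cast hn.ne'
      exact this (by simpa using ha)
    · rw [eval_pow, eval_X]
      have ha0 : a = 0 := by
        by_contra h0
        exact pow_ne_zero _ h0 ha
      rw [ha0, zero_pow hn.ne']
  · rintro a (rfl | rfl)
    · left; rw [eval_pow, eval_X, zero_pow hn.ne']
    · right; rw [eval_pow, eval_X, one_pow]

/-- **`4f(1 - f)` is a Belyi function** for a Belyi function `f` (`β = 4x(1 - x)`: the critical
point `1/2` has value `1`, and `β(0) = β(1) = 0`), of degree `2 · [F : K(f)]`. [folklore] -/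
theorem IsBelyiFunction.four_mul_mul_one_sub {f : F} (hf : IsBelyiFunction K f) :
    IsBelyiFunction K (4 * f * (1 - f)) := by
  have hdeg : (4 * X * (1 - X) : K[X]).natDegree = 2 := by
    have h : (4 * X * (1 - X) : K[X]) = C (-4) * X ^ 2 + C 4 * X := by
      simp only [map_neg, map_ofNat]; ring
    rw [h]
    compute_degree!
  have h := hf.aeval (β := 4 * X * (1 - X)) (by rw [hdeg]; norm_num) ?_ ?_
  · simpa [map_ofNat] using h
  · intro a ha
    right
    have hda : (derivative (4 * X * (1 - X) : K[X])).eval a = 4 - 8 * a := by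
      simp [derivative_mul]
      ring
    rw [hda] at ha
    have ha' : a = 1 / 2 := by linear_combination (-1 / 8 : K) * ha
    rw [ha']
    simp only [eval_mul, eval_sub, eval_one, eval_X, eval_ofNat]
    norm_num
  · rintro a (rfl | rfl)
    · left; simp
    · left; simp

/-- A Belyi function of degree `d` yields Belyi functions of every degree `n d`, `n ≥ 1`.
[folklore] -/
theorem exists_isBelyiFunction_finrank_eq_mul {f : F} (hf : IsBelyiFunction K f) {n : ℕ}
    (hn : 0 < n) :
    ∃ g : F, IsBelyiFunction K g ∧ Module.finrank K⟮g⟯ F = n * Module.finrank K⟮f⟯ F := by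
  haveI := isIntegrallyClosedIn_of_isAlgClosed (K := K) (F := F)
  refine ⟨f ^ n, hf.pow hn, ?_⟩
  have h := finrank_adjoin_aeval (transcendental_of_not_mem_range hf.1) (β := (X ^ n : K[X]))
    (by rwa [natDegree_X_pow])
  rwa [aeval_X_pow, natDegree_X_pow] at h

end algClosed

end Literature.NumberTheory.DiophantineGeometry.AlgFunctionField
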